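/-
Copyright (c) 2026 the pub-hodgecm-mathlib formalisation cell (harness21).  Prover seat hodgecm-mathlib-LH7-p06 (g2) (LH7 hand lent to L1; LEAD F0P6-plan (g14) BATCH #166 (2);
desk K2E3-p14 (g9) carrier ask 00:12:13Z ∕ 00:13:23Z), Track B "K2-LIT" ∕ hLiu418 = stmt-HodgeConjecture-24832: U1-CT-ind stage 3 ("U1-glob"), brick B2b LEVEL 2 — the `hN₃`
producer ON ANY CARRIER `N′ = unipDeltaLocal` and at the CM datum on `unipDeltaLoc v₀` (the ★ TailGlue §1∕§2 pattern).
THEOREMS ONLY (no `def`∕`instance`∕notation∕`sorry`).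
-/
import Summits.HodgeConjecture.HodgeConjecture.Theorems.K2LiuLocalKernelN3Reading               -- ★ FILE B (this seat): `localKernelN3_half_eq_zero_of_record` (Γ-free socket)
import Summits.HodgeConjecture.HodgeConjecture.Theorems.K2LiuRankOneCornerCharacterReading      -- ★ p862906 (K2E5-p16): brings ★ B1 `unipDeltaLoc_eq_unipDeltaLocal`, ★ `evalPlace_finPart_weylDelta`
import HarnessLib

/-!
# Crux `HLiu418`, organ U1-CT-ind STAGE 3 ("U1-glob"), brick B2b LEVEL 2 — THE `hN₃` PRODUCER ON THE CARRIER OF RECORD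
# [KudlaRallis1994 §2; KudlaSweet1997 §1; Casselman1980 §3 Thm. 3.1; CasselmanShalika1980 §4; MoeglinWaldspurger1995 I.2.1]

Cell `hodgecm-mathlib`, crux item hLiu418 = `stmt-HodgeConjecture-24832`; squad K2, strike line L1, LEAD F0P6-plan (g14) BATCH #166 (2); desk K2E3-p14 (g9) (carrier ask
00:12:13Z, merge 00:13:23Z); prover LH7-p06 (g2).  Lane `--supports stmt-HodgeConjecture-24832 --as helper` (count-neutral).

WHY.  ★ FILE B `K2LiuLocalKernelN3Reading.localKernelN3_half_eq_zero_of_record` is stated on the LITERAL subgroup `unipDeltaLocal F E c v 2` with `νN : Measure ↥unipDeltaLocal`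
inside U1's clause (`localIntertwining … νN (f s) h`, volume `νN.real {u | ↑u ∈ K₀}`).  LEVEL 2-fin lives on ★ G1's carrier `↥(unipDeltaLoc v₀)` with its Haar measure, and the
two subtypes are only PROPOSITIONALLY equal (★ B1 `unipDeltaLoc_eq_unipDeltaLocal`) — a measure is not pushed across `Eq.mpr`; hence, exactly as ★ TailGlue §1∕§2 did for
★ p862989:
* §1 `localKernelN3_half_eq_zero_of_eq_unipDeltaLocal` — FILE B's Γ-free socket with the unipotent subgroup a LETTER `N′`, `hN′ : N′ = unipDeltaLocal`, coordinates
  `e3 : _ ≃ₜ N′`, Haar `νN` on `N′`, and U1's clause spelled with the EXPLICIT intertwining integral `∫ u : N′, f s (w_Δ · u · h) dνN` (= `localIntertwining` unfolded)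
  and volume `νN.real {u : N′ | ↑u ∈ K₀}` (`subst` + `exact`);
* §2 `localKernelN3_half_eq_zero_unipDeltaLoc_cm` — §1 at the K2Lit CM doubled datum (`F = L⁺`, `E = L`, `c = complexConj`, `δ = imagUnit`, `T₂ = gramR`, `J₂D = hermD`) on
  `N′ := unipDeltaLoc v₀`, with the local Weyl element spelled `evalPlace v₀ (finPart w_Δ)` (★ `evalPlace_finPart_weylDelta`) — the letters of ★ TailGlue §2 ∕ LEVEL 2-fin.
References: [KudlaRallis1994] S. Kudla, S. Rallis, Ann. of Math. 140 (1994), §2; [KudlaSweet1997] S. Kudla, W. J. Sweet, Israel J. Math. 98 (1997), §1;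
[Casselman1980] W. Casselman, Compositio Math. 40 (1980), §3 Thm. 3.1; [CasselmanShalika1980] W. Casselman, J. Shalika, Compositio Math. 41 (1980), §4;
[MoeglinWaldspurger1995] C. Moeglin, J.-L. Waldspurger, Spectral decomposition and Eisenstein series (1995), I.2.1.
HONEST LABEL.  Count-neutral helper: `HC_CM` is proved only modulo the 7 printed citations (2 remaining named inputs: hLiu418 = `stmt-HodgeConjecture-24832`,
h413 = `stmt-HodgeConjecture-24833`) until rung 0 closes; this file closes no socket — it re-keys ★ FILE B's output, LEVEL 1's `hN₃`, modulo `hU1` (U1-glob).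
-/

set_option autoImplicit false
set_option linter.dupNamespace false -- the mandated namespace repeats `HodgeConjecture.HodgeConjecture`

noncomputable section

open scoped Classical NNReal ENNReal ComplexConjugate
open NumberField IsDedekindDomain Matrix MeasureTheory Topology
open Literature.NumberTheory.GaloisRepresentations.IsNonarchimedeanLocalField
open Literature.NumberTheory.Automorphic Literature.NumberTheory.Automorphic.UnitaryGroup
open Literature.NumberTheory.GelbartRogawski1991.AdaptedBlocks
open Literature.NumberTheory.GelbartRogawski1991.UnitaryDualPair.LocalSplitting
open Literature.NumberTheory.K2Lit.LocalSiegelDoubled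
open Summit.HodgeConjecture.HodgeConjecture.Cruxes.HLiu418.K2LiuQRationalDefs
open Summit.HodgeConjecture.HodgeConjecture.Cruxes.HLiu418.K2LiuQRationalLFactor
open Summit.HodgeConjecture.HodgeConjecture.Cruxes.HLiu418.K2LiuLocalLFactorDefs
open Summit.HodgeConjecture.HodgeConjecture.Cruxes.HLiu418.K2LiuLocalSiegelIwasawaFrame
open Summit.HodgeConjecture.HodgeConjecture.Cruxes.HLiu418.K2LiuLocalSiegelIwasawa
open Summit.HodgeConjecture.HodgeConjecture.Cruxes.HLiu418.K2LiuDoubledUTwoTwoBorelFrame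
open Summit.HodgeConjecture.HodgeConjecture.Cruxes.HLiu418.K2LiuDoubledUTwoTwoWeylCocycle
open Summit.HodgeConjecture.HodgeConjecture.Cruxes.HLiu418.K2LiuDoubledUTwoTwoLevi
open Summit.HodgeConjecture.HodgeConjecture.Cruxes.HLiu418.K2LiuDoubledUTwoTwoFrameTransport
open Summit.HodgeConjecture.HodgeConjecture.Cruxes.HLiu418.K2LiuDoubledUTwoTwoUnipotentCoordinates
open Summit.HodgeConjecture.HodgeConjecture.Cruxes.HLiu418.K2LiuDoubledUTwoTwoUnipotentHaar
open Summit.HodgeConjecture.HodgeConjecture.Cruxes.HLiu418.K2LiuDoubledUTwoTwoLeviTransport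
open Summit.HodgeConjecture.HodgeConjecture.Cruxes.HLiu418.K2LiuUnipDeltaRankOneCoordinates
open Summit.HodgeConjecture.HodgeConjecture.Cruxes.HLiu418.K2LiuSiegelCocycleLetters
open Summit.HodgeConjecture.HodgeConjecture.Cruxes.HLiu418.K2LiuSiegelCocycleStageLetters
open Summit.HodgeConjecture.HodgeConjecture.Cruxes.HLiu418.K2LiuFlatSiegelFamilies
open Summit.HodgeConjecture.HodgeConjecture.Cruxes.HLiu418.K2LiuLocalRingPlaceDecomposition
open Summit.HodgeConjecture.HodgeConjecture.Cruxes.HLiu418.K2LiuLocalKernelN3Reading (localKernelN3_half_eq_zero_of_record)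

namespace Summit.HodgeConjecture.HodgeConjecture.Cruxes.HLiu418.K2LiuLocalKernelN3ReadingCarrier

/-! ## §1 Any carrier `N′ = unipDeltaLocal` (`subst`) -/

section Generic

variable (F : Type) [Field F] [NumberField F] (E : Type) [Field E] [NumberField E] [Algebra F E]
  [Algebra.IsQuadraticExtension F E] (c : E ≃ₐ[F] E)
  {δ : E} (hcδ : c δ = -δ) (hδ : δ ≠ 0) {d : F} (hd : δ * δ = algebraMap F E d) (v : HeightOneSpectrum (𝓞 F))
  {T₂ : Matrix (Fin 2) (Fin 2) F} (hT₂ : T₂.IsSymm) {J₂D : Matrix (Fin (2 + 2)) (Fin (2 + 2)) E} (hJ₂D : J₂D = (gramD F 2 T₂).map (algebraMap F E))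
  (D Dinv : Matrix (Fin 2) (Fin 2) F) (hDD : D * Dinv = 1) (Q : GL (Fin (2 + 2)) F)
  (hQm : (Q : Matrix (Fin (2 + 2)) (Fin (2 + 2)) F) = Matrix.reindex (e₂ 2) (e₂ 2) (Matrix.fromBlocks 1 D 1 (-D)))
  (hQ : (Q : Matrix (Fin (2 + 2)) (Fin (2 + 2)) F)ᵀ * gramD F 2 T₂ * (Q : Matrix (Fin (2 + 2)) (Fin (2 + 2)) F) = (StdForm.antidiagonal (2 + 2)).over F)

include hcδ hδ hd hT₂ hDD hQm hQ in
/-- **THE `hN₃` PRODUCER ON ANY CARRIER `N′ = unipDeltaLocal`** (e.g. the global-comap `unipDeltaLoc v₀` of ★ FILE 2 p862998 via ★ B1): ★ FILE B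
`localKernelN3_half_eq_zero_of_record` with the unipotent subgroup a letter `N′`, `hN′ : N′ = unipDeltaLocal`, coordinates `e3 : _ ≃ₜ N′`, Haar `νN` on `N′`, and U1's finite
clause spelled with the EXPLICIT intertwining integral `M_v(s)(f s) h = ∫ u : N′, f s (w_Δ·u·h) dνN` and volume `νN(N′ ∩ K₀)`: **`∀ h, N₃ (1/2) h = 0`** (`subst` + `exact`).
[cite: KudlaRallis1994, §2] [cite: KudlaSweet1997, §1] [cite: Casselman1980, §3 Thm. 3.1] [cite: CasselmanShalika1980, §4] [cite: MoeglinWaldspurger1995, I.2.1] -/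
theorem localKernelN3_half_eq_zero_of_eq_unipDeltaLocal {N' : Subgroup (UnitaryGroup.localPi E c (2 + 2) J₂D v)} (hN' : N' = unipDeltaLocal F E c v 2 (JD := J₂D))
    [MeasurableSpace (N')] [BorelSpace (N')] (νN : Measure (N')) [νN.IsHaarMeasure]
    [MeasurableSpace (v.adicCompletion F)] [BorelSpace (v.adicCompletion F)] (μF : Measure (v.adicCompletion F)) [μF.IsAddHaarMeasure]
    (χv : ∀ w : PlacesOver E v, (w.1.adicCompletion E)ˣ →* ℂˣ) (hχ : ∀ (w' : PlacesOver E v) (x : (w'.1.adicCompletion E)ˣ), ‖((χv w' x : ℂˣ) : ℂ)‖ = 1)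
    (K₀ : Subgroup (UnitaryGroup.localPi E c (2 + 2) J₂D v))
    (hK₀ : IsCompact (K₀ : Set (UnitaryGroup.localPi E c (2 + 2) J₂D v)) ∧ IsOpen (K₀ : Set (UnitaryGroup.localPi E c (2 + 2) J₂D v)))
    (hIw : ∀ g : UnitaryGroup.localPi E c (2 + 2) J₂D v, ∃ p, IsSiegelDelta F E c hcδ hδ hd v 2 hT₂ hJ₂D p ∧ ∃ k ∈ K₀, g = p * k)
    (f : ℂ → UnitaryGroup.localPi E c (2 + 2) J₂D v → ℂ) (hSieg : ∀ s, IsLocalSiegelSection F E c hcδ hδ hd v 2 hT₂ hJ₂D χv s (f s)) (hsm : ∀ s, IsSmooth F E c v 2 (f s))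
    (hflat : ∀ s s' : ℂ, ∀ k ∈ K₀, f s k = f s' k)
    (e3 : (v.adicCompletion F × UnitaryGroup.LocalRing E v × v.adicCompletion F) ≃ₜ N')
    (he3 : ∀ b₁ z b₂, ((e3 (b₁, z, b₂) : N') : UnitaryGroup.localPi E c (2 + 2) J₂D v) = FrameTransport.frameConj F E c v (2 + 2) hJ₂D (antidiagonal_over_eq_map F E 2) Q hQ (toLocalFour F E c v (nSiegel (UnitaryGroup.LocalRing E v) (UnitaryGroup.conjLocal E c v) (UnitaryGroup.conjLocal_conjLocal c v hcδ hδ) (UnitaryGroup.toLocalRing E v b₁ * algebraMap E (UnitaryGroup.LocalRing E v) δ) z (UnitaryGroup.toLocalRing E v b₂ * algebraMap E (UnitaryGroup.LocalRing E v) δ) (conjLocal_coord F E c hcδ v b₁) (conjLocal_coord F E c hcδ v b₂))))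
    (he3mul : ∀ p p', e3 (p + p') = e3 p * e3 p')
    (ψ : AddChar (v.adicCompletion F) Circle) (_hψ : Continuous ψ) {mψ : ℤ} (hmψ : ψ.HasConductorExp mψ) {σ : v.adicCompletion F} (hσ : σ ≠ 0)
    (w : PlacesOver E v) (hw : ∀ w' : PlacesOver E v, w' = w)
    [MeasurableSpace (w.1.adicCompletion E)] [BorelSpace (w.1.adicCompletion E)] (μw : Measure (w.1.adicCompletion E)) [μw.IsAddHaarMeasure]
    -- ★ p862989's witnesses BY VALUE
    (A : GL (Fin 2) (UnitaryGroup.LocalRing E v)) (hA : A.val = !![1 - Pi.single w 1, Pi.single w 1; Pi.single w 1, 1 - Pi.single w 1])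
    (N₁ N₂ N₃ : ℂ → UnitaryGroup.localPi E c (2 + 2) J₂D v → ℂ)
    (hN₂reg : ∀ (s₀ : ℂ) (g : UnitaryGroup.localPi E c (2 + 2) J₂D v), IsQRationalRegularAt (residueFieldCard (v.adicCompletion F)) s₀ fun s => N₂ s g)
    (hN₃reg : ∀ (s₀ : ℂ) (g : UnitaryGroup.localPi E c (2 + 2) J₂D v), IsQRationalRegularAt (residueFieldCard (v.adicCompletion F)) s₀ fun s => N₃ s g)
    (htw : ∀ s : ℂ, 1 < s.re → ∀ h : UnitaryGroup.localPi E c (2 + 2) J₂D v,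
      Integrable (fun x => conj ((ψ (σ * x) : ℂ)) * N₂ s (FrameTransport.frameConj F E c v (2 + 2) hJ₂D (antidiagonal_over_eq_map F E 2) Q hQ (toLocalFour F E c v (weylTwo (UnitaryGroup.LocalRing E v) (UnitaryGroup.conjLocal E c v))) * FrameTransport.frameConj F E c v (2 + 2) hJ₂D (antidiagonal_over_eq_map F E 2) Q hQ (toLocalFour F E c v (uLongTwo (UnitaryGroup.LocalRing E v) (UnitaryGroup.conjLocal E c v) (UnitaryGroup.toLocalRing E v x * algebraMap E (UnitaryGroup.LocalRing E v) δ) (conjLocal_coord F E c hcδ v x))) * h)) μF ∧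
        ∫ x, conj ((ψ (σ * x) : ℂ)) * N₂ s (FrameTransport.frameConj F E c v (2 + 2) hJ₂D (antidiagonal_over_eq_map F E 2) Q hQ (toLocalFour F E c v (weylTwo (UnitaryGroup.LocalRing E v) (UnitaryGroup.conjLocal E c v))) * FrameTransport.frameConj F E c v (2 + 2) hJ₂D (antidiagonal_over_eq_map F E 2) Q hQ (toLocalFour F E c v (uLongTwo (UnitaryGroup.LocalRing E v) (UnitaryGroup.conjLocal E c v) (UnitaryGroup.toLocalRing E v x * algebraMap E (UnitaryGroup.LocalRing E v) δ) (conjLocal_coord F E c hcδ v x))) * h) ∂μF = N₃ s h)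
    (hstage : ∀ s : ℂ, 1 < s.re →
      (∀ g : UnitaryGroup.localPi E c (2 + 2) J₂D v, N₁ s g = (lF F E v χv (2 * s + 1))⁻¹ * ∫ y, f s (FrameTransport.frameConj F E c v (2 + 2) hJ₂D (antidiagonal_over_eq_map F E 2) Q hQ (toLocalFour F E c v (weylTwo (UnitaryGroup.LocalRing E v) (UnitaryGroup.conjLocal E c v))) * FrameTransport.frameConj F E c v (2 + 2) hJ₂D (antidiagonal_over_eq_map F E 2) Q hQ (toLocalFour F E c v (uLongTwo (UnitaryGroup.LocalRing E v) (UnitaryGroup.conjLocal E c v) (UnitaryGroup.toLocalRing E v y * algebraMap E (UnitaryGroup.LocalRing E v) δ) (conjLocal_coord F E c hcδ v y))) * g) ∂μF) ∧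
      (∀ g : UnitaryGroup.localPi E c (2 + 2) J₂D v, N₂ s g = (lEN F E c v χv (2 * s))⁻¹ * ∫ ζ, N₁ s (FrameTransport.frameConj F E c v (2 + 2) hJ₂D (antidiagonal_over_eq_map F E 2) Q hQ (toLocalFour F E c v (leviElt (UnitaryGroup.LocalRing E v) (UnitaryGroup.conjLocal E c v) (UnitaryGroup.conjLocal_conjLocal c v hcδ hδ) A)) * FrameTransport.frameConj F E c v (2 + 2) hJ₂D (antidiagonal_over_eq_map F E 2) Q hQ (toLocalFour F E c v (uMinus (UnitaryGroup.LocalRing E v) (UnitaryGroup.conjLocal E c v) (UnitaryGroup.conjLocal_conjLocal c v hcδ hδ) (Pi.single w ζ))) * g) ∂μw))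
    -- the conductor letter of `χ_F`
    (cν : ℤ)
    (hνc : ∀ x : (v.adicCompletion F)ˣ, normAbs (v.adicCompletion F) (x : v.adicCompletion F) = 1 →
      (x : v.adicCompletion F) - 1 ∈ primePowBall (v.adicCompletion F) cν → chiF F E v χv x = 1)
    -- U1's finite clause at this family, the intertwining integral spelled out on `N′`
    (hU1 : ∀ Fn : ℂ → UnitaryGroup.localPi E c (2 + 2) J₂D v → ℂ,
      (∀ s : ℂ, 1 < s.re → ∀ h : UnitaryGroup.localPi E c (2 + 2) J₂D v,
        ∫ u : N', f s (weylDelta F E c v 2 hJ₂D (T₀ := T₂) * (u : UnitaryGroup.localPi E c (2 + 2) J₂D v) * h) ∂νN = aNorm F E c v 2 χv (νN.real {u : N' | (u : UnitaryGroup.localPi E c (2 + 2) J₂D v) ∈ K₀}) s * Fn s h) →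
      (∀ h : UnitaryGroup.localPi E c (2 + 2) J₂D v, IsQRationalRegularAt (residueFieldCard (v.adicCompletion F)) (1 / 2) (fun s => Fn s h)) →
      ∀ h : UnitaryGroup.localPi E c (2 + 2) J₂D v, Fn (1 / 2) h = 0) :
    ∀ h : UnitaryGroup.localPi E c (2 + 2) J₂D v, N₃ (1 / 2) h = 0 := by
  subst hN'
  exact localKernelN3_half_eq_zero_of_record F E c hcδ hδ hd v hT₂ hJ₂D D Dinv hDD Q hQm hQ νN μF χv hχ K₀ hK₀ hIw f hSieg hsm hflat e3 he3 he3mul ψ _hψ hmψ hσ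
    w hw μw A hA N₁ N₂ N₃ hN₂reg hN₃reg htw hstage cν hνc hU1

end Generic

/-! ## §2 The CM instance on ★ FILE 2's subgroup `unipDeltaLoc v₀`, with `(w_Δ)_{v₀} = evalPlace v₀ (finPart w_Δ)` -/

section CM

open Literature.NumberTheory.GaloisRepresentations
open Literature.NumberTheory.GelbartRogawski1991 Literature.NumberTheory.GelbartRogawski1991.GRConstruction
open Literature.NumberTheory.GelbartRogawski1991.UnitaryDualPair
open Summit.HodgeConjecture.HodgeConjecture.Cruxes.HLiu418.K2LiuSiegelUnipotentLocalDefs (unipDeltaLoc)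
open Summit.HodgeConjecture.HodgeConjecture.Cruxes.HLiu418.K2LiuUnipDeltaLocBridge (unipDeltaLoc_eq_unipDeltaLocal)
open Summit.HodgeConjecture.HodgeConjecture.Cruxes.HLiu418.K2LiuLocalWhittakerFactorSkew (evalPlace_finPart_weylDelta)

variable (L : Type) [Field L] [NumberField L] [IsCMField L] {N M : ℕ} (e : Fin N × Fin M ≃ Fin 2)
  (dV : Fin N → L) (hdV : ∀ i, IsCMField.complexConj L (dV i) = dV i) (dW : Fin M → L) (hdW : ∀ i, IsCMField.complexConj L (dW i) = dW i)
  (v₀ : HeightOneSpectrum (𝓞 (Fp L)))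
  -- the A7 frame at `v₀` of the CM datum `T₂ = gramR` — LETTERS: `(D, Dinv, Q)`
  (D Dinv : Matrix (Fin 2) (Fin 2) (Fp L)) (hDD : D * Dinv = 1) (Q : GL (Fin (2 + 2)) (Fp L))
  (hQm : (Q : Matrix (Fin (2 + 2)) (Fin (2 + 2)) (Fp L)) = Matrix.reindex (e₂ 2) (e₂ 2) (Matrix.fromBlocks 1 D 1 (-D)))
  (hQ : (Q : Matrix (Fin (2 + 2)) (Fin (2 + 2)) (Fp L))ᵀ * gramD (Fp L) 2 (gramR L e dV hdV dW hdW) * (Q : Matrix (Fin (2 + 2)) (Fin (2 + 2)) (Fp L)) =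
    (StdForm.antidiagonal (2 + 2)).over (Fp L))

include hDD hQm in
set_option maxHeartbeats 1600000 in -- as ★ TailGlue §2 (MEASURED there 2026-09-05: 800 000 ✗, 1 600 000 ✓ for §1 applied at the K2Lit CM telescope, split into `have`s)
/-- **THE `hN₃` PRODUCER AT THE CM DATUM ON `unipDeltaLoc v₀`** (★ FILE 2 p862998's carrier and Weyl letter, as ★ TailGlue §2): §1 for the K2Lit CM doubled datum
(`F = L⁺`, `E = L`, `c = complexConj`, `δ = imagUnit`, `T₂ = gramR`, `J₂D = hermD`) at a finite place `v₀`, for ANY Haar measure `νN` on `unipDeltaLoc v₀`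
(★ B1 `unipDeltaLoc_eq_unipDeltaLocal`), U1's clause spelled with `(w_Δ)_{v₀} = evalPlace v₀ (finPart w_Δ)` (★ `evalPlace_finPart_weylDelta`); the A7 frame `(D, Dinv, Q)`,
`e3`, `ψ, σ ≠ 0, w, μF, μw, χv, K₀, f` and ★ p862989's witnesses `(A, N₁, N₂, N₃)` BY VALUE are LETTERS: **`∀ h, N₃ (1/2) h = 0`**.
[cite: KudlaRallis1994, §2] [cite: KudlaSweet1997, §1] [cite: Casselman1980, §3 Thm. 3.1] [cite: CasselmanShalika1980, §4] [cite: Kudla1994, §3] -/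
theorem localKernelN3_half_eq_zero_unipDeltaLoc_cm
    [MeasurableSpace (unipDeltaLoc L e dV hdV dW hdW v₀)] [BorelSpace (unipDeltaLoc L e dV hdV dW hdW v₀)]
    (νN : Measure (unipDeltaLoc L e dV hdV dW hdW v₀)) [νN.IsHaarMeasure]
    [MeasurableSpace (v₀.adicCompletion (Fp L))] [BorelSpace (v₀.adicCompletion (Fp L))] (μF : Measure (v₀.adicCompletion (Fp L))) [μF.IsAddHaarMeasure]
    (χv : ∀ w : PlacesOver L v₀, (w.1.adicCompletion L)ˣ →* ℂˣ) (hχ : ∀ (w' : PlacesOver L v₀) (x : (w'.1.adicCompletion L)ˣ), ‖((χv w' x : ℂˣ) : ℂ)‖ = 1)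
    (K₀ : Subgroup (UnitaryGroup.localPi L (IsCMField.complexConj L) (2 + 2) (hermD L e dV hdV dW hdW) v₀))
    (hK₀ : IsCompact (K₀ : Set (UnitaryGroup.localPi L (IsCMField.complexConj L) (2 + 2) (hermD L e dV hdV dW hdW) v₀)) ∧ IsOpen (K₀ : Set (UnitaryGroup.localPi L (IsCMField.complexConj L) (2 + 2) (hermD L e dV hdV dW hdW) v₀)))
    (hIw : haveI : Algebra.IsQuadraticExtension (Fp L) L := IsCMField.isQuadraticExtension L
      ∀ g : UnitaryGroup.localPi L (IsCMField.complexConj L) (2 + 2) (hermD L e dV hdV dW hdW) v₀, ∃ p, IsSiegelDelta (Fp L) L (IsCMField.complexConj L) (complexConj_imagUnit L) (imagUnit_ne_zero L) (imagUnit_mul_self L) v₀ 2 (gramR_isSymm L e dV hdV dW hdW) (hermD_eq_map_gramD L e dV hdV dW hdW) p ∧ ∃ k ∈ K₀, g = p * k)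
    (f : ℂ → UnitaryGroup.localPi L (IsCMField.complexConj L) (2 + 2) (hermD L e dV hdV dW hdW) v₀ → ℂ) (hSieg : haveI : Algebra.IsQuadraticExtension (Fp L) L := IsCMField.isQuadraticExtension L
      ∀ s, IsLocalSiegelSection (Fp L) L (IsCMField.complexConj L) (complexConj_imagUnit L) (imagUnit_ne_zero L) (imagUnit_mul_self L) v₀ 2 (gramR_isSymm L e dV hdV dW hdW) (hermD_eq_map_gramD L e dV hdV dW hdW) χv s (f s))
    (hsm : ∀ s, IsSmooth (Fp L) L (IsCMField.complexConj L) v₀ 2 (f s))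
    (hflat : ∀ s s' : ℂ, ∀ k ∈ K₀, f s k = f s' k)
    (e3 : (v₀.adicCompletion (Fp L) × UnitaryGroup.LocalRing L v₀ × v₀.adicCompletion (Fp L)) ≃ₜ unipDeltaLoc L e dV hdV dW hdW v₀)
    (he3 : haveI : Algebra.IsQuadraticExtension (Fp L) L := IsCMField.isQuadraticExtension L
      ∀ b₁ z b₂, ((e3 (b₁, z, b₂) : unipDeltaLoc L e dV hdV dW hdW v₀) : UnitaryGroup.localPi L (IsCMField.complexConj L) (2 + 2) (hermD L e dV hdV dW hdW) v₀) = FrameTransport.frameConj (Fp L) L (IsCMField.complexConj L) v₀ (2 + 2) (hermD_eq_map_gramD L e dV hdV dW hdW) (antidiagonal_over_eq_map (Fp L) L 2) Q hQ (toLocalFour (Fp L) L (IsCMField.complexConj L) v₀ (nSiegel (UnitaryGroup.LocalRing L v₀) (UnitaryGroup.conjLocal L (IsCMField.complexConj L) v₀) (UnitaryGroup.conjLocal_conjLocal (IsCMField.complexConj L) v₀ (complexConj_imagUnit L) (imagUnit_ne_zero L)) (UnitaryGroup.toLocalRing L v₀ b₁ * algebraMap L (UnitaryGroup.LocalRing L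 v₀) (imagUnit L)) z (UnitaryGroup.toLocalRing L v₀ b₂ * algebraMap L (UnitaryGroup.LocalRing L v₀) (imagUnit L)) (conjLocal_coord (Fp L) L (IsCMField.complexConj L) (complexConj_imagUnit L) v₀ b₁) (conjLocal_coord (Fp L) L (IsCMField.complexConj L) (complexConj_imagUnit L) v₀ b₂))))
    (he3mul : ∀ p p', e3 (p + p') = e3 p * e3 p')
    (ψ : AddChar (v₀.adicCompletion (Fp L)) Circle) (hψ : Continuous ψ) {mψ : ℤ} (hmψ : ψ.HasConductorExp mψ) {σ : v₀.adicCompletion (Fp L)} (hσ : σ ≠ 0)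
    (w : PlacesOver L v₀) (hw : ∀ w' : PlacesOver L v₀, w' = w)
    [MeasurableSpace (w.1.adicCompletion L)] [BorelSpace (w.1.adicCompletion L)] (μw : Measure (w.1.adicCompletion L)) [μw.IsAddHaarMeasure]
    -- ★ p862989's (★ TailGlue §2's) witnesses BY VALUE
    (A : GL (Fin 2) (UnitaryGroup.LocalRing L v₀)) (hA : A.val = !![1 - Pi.single w 1, Pi.single w 1; Pi.single w 1, 1 - Pi.single w 1])
    (N₁ N₂ N₃ : ℂ → UnitaryGroup.localPi L (IsCMField.complexConj L) (2 + 2) (hermD L e dV hdV dW hdW) v₀ → ℂ)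
    (hN₂reg : ∀ (s₀ : ℂ) (g : UnitaryGroup.localPi L (IsCMField.complexConj L) (2 + 2) (hermD L e dV hdV dW hdW) v₀), IsQRationalRegularAt (residueFieldCard (v₀.adicCompletion (Fp L))) s₀ fun s => N₂ s g)
    (hN₃reg : ∀ (s₀ : ℂ) (g : UnitaryGroup.localPi L (IsCMField.complexConj L) (2 + 2) (hermD L e dV hdV dW hdW) v₀), IsQRationalRegularAt (residueFieldCard (v₀.adicCompletion (Fp L))) s₀ fun s => N₃ s g)
    (htw : haveI : Algebra.IsQuadraticExtension (Fp L) L := IsCMField.isQuadraticExtension L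
      ∀ s : ℂ, 1 < s.re → ∀ h : UnitaryGroup.localPi L (IsCMField.complexConj L) (2 + 2) (hermD L e dV hdV dW hdW) v₀,
      Integrable (fun x => conj ((ψ (σ * x) : ℂ)) * N₂ s (FrameTransport.frameConj (Fp L) L (IsCMField.complexConj L) v₀ (2 + 2) (hermD_eq_map_gramD L e dV hdV dW hdW) (antidiagonal_over_eq_map (Fp L) L 2) Q hQ (toLocalFour (Fp L) L (IsCMField.complexConj L) v₀ (weylTwo (UnitaryGroup.LocalRing L v₀) (UnitaryGroup.conjLocal L (IsCMField.complexConj L) v₀))) * FrameTransport.frameConj (Fp L) L (IsCMField.complexConj L) v₀ (2 + 2) (hermD_eq_map_gramD L e dV hdV dW hdW) (antidiagonal_over_eq_map (Fp L) L 2) Q hQ (toLocalFour (Fp L) L (IsCMField.complexConj L) v₀ (uLongTwo (UnitaryGroup.LocalRing L v₀) (UnitaryGroup.conjLocal L (IsCMField.complexConj L) v₀) (UnitaryGroup.toLocalRing L v₀ x * algebraMap L (UnitaryGroup.LocalRing L v₀) (imagUnit L)) (conjLocal_coord (Fp L) L (IsCMField.complexConj L) (complexConj_imagUnit L) v₀ x)))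 * h)) μF ∧
        ∫ x, conj ((ψ (σ * x) : ℂ)) * N₂ s (FrameTransport.frameConj (Fp L) L (IsCMField.complexConj L) v₀ (2 + 2) (hermD_eq_map_gramD L e dV hdV dW hdW) (antidiagonal_over_eq_map (Fp L) L 2) Q hQ (toLocalFour (Fp L) L (IsCMField.complexConj L) v₀ (weylTwo (UnitaryGroup.LocalRing L v₀) (UnitaryGroup.conjLocal L (IsCMField.complexConj L) v₀))) * FrameTransport.frameConj (Fp L) L (IsCMField.complexConj L) v₀ (2 + 2) (hermD_eq_map_gramD L e dV hdV dW hdW) (antidiagonal_over_eq_map (Fp L) L 2) Q hQ (toLocalFour (Fp L) L (IsCMField.complexConj L) v₀ (uLongTwo (UnitaryGroup.LocalRing L v₀) (UnitaryGroup.conjLocal L (IsCMField.complexConj L) v₀) (UnitaryGroup.toLocalRing L v₀ x * algebraMap L (UnitaryGroup.LocalRing L v₀) (imagUnit L)) (conjLocal_coord (Fp L) L (IsCMField.complexConj L) (complexConj_imagUnit L) v₀ x))) * h) ∂μF = N₃ s h)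
    (hstage : haveI : Algebra.IsQuadraticExtension (Fp L) L := IsCMField.isQuadraticExtension L
      ∀ s : ℂ, 1 < s.re →
      (∀ g : UnitaryGroup.localPi L (IsCMField.complexConj L) (2 + 2) (hermD L e dV hdV dW hdW) v₀, N₁ s g = (lF (Fp L) L v₀ χv (2 * s + 1))⁻¹ * ∫ y, f s (FrameTransport.frameConj (Fp L) L (IsCMField.complexConj L) v₀ (2 + 2) (hermD_eq_map_gramD L e dV hdV dW hdW) (antidiagonal_over_eq_map (Fp L) L 2) Q hQ (toLocalFour (Fp L) L (IsCMField.complexConj L) v₀ (weylTwo (UnitaryGroup.LocalRing L v₀) (UnitaryGroup.conjLocal L (IsCMField.complexConj L) v₀))) * FrameTransport.frameConj (Fp L) L (IsCMField.complexConj L) v₀ (2 + 2) (hermD_eq_map_gramD L e dV hdV dW hdW) (antidiagonal_over_eq_map (Fp L) L 2) Q hQ (toLocalFour (Fp L) L (IsCMField.complexConj L) v₀ (uLongTwo (UnitaryGroup.LocalRing L v₀) (UnitaryGroup.conjLocal L (IsCMField.complexConj L) v₀) (UnitaryGroup.toLocalRing L v₀ y * algebraMap L (UnitaryGroup.LocalRing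 L v₀) (imagUnit L)) (conjLocal_coord (Fp L) L (IsCMField.complexConj L) (complexConj_imagUnit L) v₀ y))) * g) ∂μF) ∧
      (∀ g : UnitaryGroup.localPi L (IsCMField.complexConj L) (2 + 2) (hermD L e dV hdV dW hdW) v₀, N₂ s g = (lEN (Fp L) L (IsCMField.complexConj L) v₀ χv (2 * s))⁻¹ * ∫ ζ, N₁ s (FrameTransport.frameConj (Fp L) L (IsCMField.complexConj L) v₀ (2 + 2) (hermD_eq_map_gramD L e dV hdV dW hdW) (antidiagonal_over_eq_map (Fp L) L 2) Q hQ (toLocalFour (Fp L) L (IsCMField.complexConj L) v₀ (leviElt (UnitaryGroup.LocalRing L v₀) (UnitaryGroup.conjLocal L (IsCMField.complexConj L) v₀) (UnitaryGroup.conjLocal_conjLocal (IsCMField.complexConj L) v₀ (complexConj_imagUnit L) (imagUnit_ne_zero L)) A)) * FrameTransport.frameConj (Fp L) L (IsCMField.complexConj L) v₀ (2 + 2) (hermD_eq_map_gramD L e dV hdV dW hdW) (antidiagonal_over_eq_map (Fp L) L 2) Q hQ (toLocalFour (Fp L) L (IsCMField.complexConj L) v₀ (uMinus (UnitaryGroup.LocalRing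 L v₀) (UnitaryGroup.conjLocal L (IsCMField.complexConj L) v₀) (UnitaryGroup.conjLocal_conjLocal (IsCMField.complexConj L) v₀ (complexConj_imagUnit L) (imagUnit_ne_zero L)) (Pi.single w ζ))) * g) ∂μw))
    -- the conductor letter of `χ_F`
    (cν : ℤ)
    (hνc : ∀ x : (v₀.adicCompletion (Fp L))ˣ, normAbs (v₀.adicCompletion (Fp L)) (x : v₀.adicCompletion (Fp L)) = 1 →
      (x : v₀.adicCompletion (Fp L)) - 1 ∈ primePowBall (v₀.adicCompletion (Fp L)) cν → chiF (Fp L) L v₀ χv x = 1)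
    -- U1's finite clause at this family ON `unipDeltaLoc v₀`, Weyl letter `evalPlace v₀ (finPart w_Δ)`
    (hU1 : haveI : Algebra.IsQuadraticExtension (Fp L) L := IsCMField.isQuadraticExtension L
      ∀ Fn : ℂ → UnitaryGroup.localPi L (IsCMField.complexConj L) (2 + 2) (hermD L e dV hdV dW hdW) v₀ → ℂ,
      (∀ s : ℂ, 1 < s.re → ∀ h : UnitaryGroup.localPi L (IsCMField.complexConj L) (2 + 2) (hermD L e dV hdV dW hdW) v₀,
        ∫ u : unipDeltaLoc L e dV hdV dW hdW v₀, f s (UnitaryGroup.evalPlace (Fp L) L (IsCMField.complexConj L) (2 + 2) (hermD L e dV hdV dW hdW) v₀ (UnitaryGroup.finPart (Fp L) L (IsCMField.complexConj L) (2 + 2) (hermD L e dV hdV dW hdW) (Literature.NumberTheory.K2Lit.SiegelDoubled.weylDelta L e dV hdV dW hdW)) * (u : UnitaryGroup.localPi L (IsCMField.complexConj L) (2 + 2) (hermD L e dV hdV dW hdW) v₀) * h) ∂νN =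
          aNorm (Fp L) L (IsCMField.complexConj L) v₀ 2 χv (νN.real {u : unipDeltaLoc L e dV hdV dW hdW v₀ | (u : UnitaryGroup.localPi L (IsCMField.complexConj L) (2 + 2) (hermD L e dV hdV dW hdW) v₀) ∈ K₀}) s * Fn s h) →
      (∀ h : UnitaryGroup.localPi L (IsCMField.complexConj L) (2 + 2) (hermD L e dV hdV dW hdW) v₀, IsQRationalRegularAt (residueFieldCard (v₀.adicCompletion (Fp L))) (1 / 2) (fun s => Fn s h)) →
      ∀ h : UnitaryGroup.localPi L (IsCMField.complexConj L) (2 + 2) (hermD L e dV hdV dW hdW) v₀, Fn (1 / 2) h = 0) :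
    ∀ h : UnitaryGroup.localPi L (IsCMField.complexConj L) (2 + 2) (hermD L e dV hdV dW hdW) v₀, N₃ (1 / 2) h = 0 := by
  haveI : Algebra.IsQuadraticExtension (Fp L) L := IsCMField.isQuadraticExtension L
  -- the Weyl letter back to the local `w_Δ`
  simp only [evalPlace_finPart_weylDelta L e dV hdV dW hdW v₀] at hU1
  -- §1 applied binder group by binder group (the ★ (E10c) ∕ ★ TailGlue §2 pattern), then `exact`
  have h₀ := localKernelN3_half_eq_zero_of_eq_unipDeltaLocal (Fp L) L (IsCMField.complexConj L) (complexConj_imagUnit L) (imagUnit_ne_zero L)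
    (imagUnit_mul_self L) v₀ (gramR_isSymm L e dV hdV dW hdW) (hermD_eq_map_gramD L e dV hdV dW hdW) D Dinv hDD Q hQm hQ
    (N' := unipDeltaLoc L e dV hdV dW hdW v₀) (unipDeltaLoc_eq_unipDeltaLocal L e dV hdV dW hdW v₀) νN μF χv hχ K₀ hK₀
  have h₁ := h₀ hIw f
  have h₂ := h₁ hSieg
  have h₃ := h₂ hsm hflat e3
  have h₄ := h₃ he3
  have h₅ := h₄ he3mul ψ hψ hmψ hσ w hw μw A hA N₁ N₂ N₃ hN₂reg hN₃reg
  have h₆ := h₅ htw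
  have h₇ := h₆ hstage cν hνc
  exact h₇ hU1

end CM

end Summit.HodgeConjecture.HodgeConjecture.Cruxes.HLiu418.K2LiuLocalKernelN3ReadingCarrier

end
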